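import Summits.QuantumFields.BalabanUV.Beta.GAN24.PushRowCoarseWardChain
import Summits.QuantumFields.BalabanUV.Beta.GAN24.DressedLegEnvelope
import Summits.QuantumFields.BalabanUV.Beta.GAN24.RespStepBmDecompPsi

/-!
# `BalabanUV.Beta.GAN24.DressedLegSeamLowerBound` — binder row G-an2-4 ∕ (CONV-C), W-slot CT-W, route «WC-TL» ∕ «QR-LL», the (DIV)∕(DL) row's LOCATED MECHANISM
# (the OWNER gan24-p1 g30's R21-A1 ∕ R22 ∕ C-1, engine E33∕E34: «ANY block-complete gauge projector on the kernel legs costs `≍ Lc` per dressed leg at the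
# seams; `max|Π_bm wH| ∕ max|wH| = 1.51 ∕ 2.19 ∕ 2.89` at `Lc = 2 ∕ 3 ∕ 4`») AS A KERNEL LOWER BOUND, PART 3 of leaf-01 g69's «ROW-WARD»:
# **THE COARSE WARD LAW FORCES THE DRESSED LEGS TO BE `≥ L^{−(d+1)}∕(2(d+1))` ON EVERY SEAM BOND OF THE BLOCK LATTICE** — for the one-step family
# `T_m = respStepBm ρ Lc (Lc^m) (Lc^(m+1))` (`L = Lc`) and for the depth-`k` chain `legChain (respStepBmSeq ρ Lc) m k` (`L = Lc^{k+1}`), level-free in `m`: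
# leaf-12's dressed envelope `(Lc^{d+1})^{−(k+1)}` is ATTAINED at the seams up to the factor `2(d+1)`, by pigeonhole on the Ward identity alone
# (G-an2-4 formalisation swarm → CRUX TEAM (2), leaf prover `b2b-balaban-gan24-formalise-leaf-01`, gen 69, INTENT 3)

NOT IN PRINT; OUR BOOKKEEPING ([folklore] pigeonhole on a finite sum + PART 1 §3 `PushRowCoarseWard.sum_respStepBm_sub_eq_gaugeWt` ∕ PART 2 §2
`PushRowCoarseWardChain.sum_legChain_sub_eq_gaugeWt` (the coarse Ward laws, themselves leaf-12∕the OWNER's `RespStepBmGaugeLaw` ∕ leaf-01 g57's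
`RespStepBmDecompExact.legAct_legChain_dz` at an indicator potential); §4 reads leaf-12's `DressedLegEnvelope.exists_legChain_envelope` (`d = 3`) as a hypothesis shape;
generic `d` elsewhere; 0 `def`, 0 cited facts, 0 `def … : Prop`, 0 sorry).  HONEST FRAMING (cell contract,
verbatim): «discharging `BetaPertH` makes Bałaban's UV stability UNCONDITIONAL — a real constructive-QFT result; it is NOT the continuum limit and NOT the Clay problem.»
HONEST DEPENDENCY (verbatim): «continuum YM on T⁴ ⇐ BetaPertH ∧ nine spine estimates (0/9 proved); BetaPertH ⇐ (D1) ∧ (D4) ∧ CAP+tail; G-an2-4 gates asym, D1 and NE2/3/4.»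

## Why
The (DIV)∕(DL) record says each dressed KERNEL leg is `≍ Lc ×` the undressed one at block seams (E33∕E34; «ANY block-complete gauge fixing», C-1) — a COUNT.  The kernel
statement behind it needs no table, resolvent bound or engine: a leg family obeying `Σ_α (l α (y − e_α) κ u − l α y κ u) = c·gaugeWt L y κ u` (PARTs 1∕2: the dressed
one-step family, `c = (Lc^{d+1})⁻¹`; the depth-`k` chain, `c = (Lc^{(d+1)(k+1)})⁻¹`) has on every seam bond `2(d+1)` entries with signed sum `±c`, so one is `≥ |c|∕(2(d+1))`
(pigeonhole).  Against the undressed (N1) sup `A·(Lc^{d+2})⁻¹` the seam ratio is `≥ Lc∕(2(d+1)A)` (the engine's `≈ 0.7·Lc`), and leaf-12's dressed envelope is sharp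
at the seams; the undressed family escapes because its Ward datum is the gradient of a SMOOTH potential (§5), not of the block-sharp indicator.

## What (generic `d`; `[NeZero Lc]`; in-block root `toSite rr`)
* §1 **`exists_abs_ge_of_sum_sub_eq`** ([folklore] pigeonhole): `Σ_{α : Fin (d+1)} (a α − b α) = c ⟹ ∃ α, |c| ≤ 2(d+1)·|a α| ∨ |c| ≤ 2(d+1)·|b α|`;
  `abs_gaugeWt_eq_one_iff` ∕ `abs_gaugeWt_le_one`: `|gaugeWt L y κ u| = 1` iff EXACTLY ONE of `blk L u`, `blk L (u + e_κ)` is `y` (a seam bond of the block `y`);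
  **`exists_abs_ge_at_seam_of_ward`** — THE GENERIC FORM: ANY leg family obeying the coarse Ward law `Σ_α (l α (y − e_α) κ u − l α y κ u) = c·gaugeWt L y κ u`
  (an1's `hH` shape; an2's `CombChartHColumnWard` letters are instances for other charts) is `≥ |c|∕(2(d+1))` on every seam bond of `B_L(y)`.
* §2 **`exists_abs_respStepBm_ge_at_seam`**: for every level `m`, block `y` and bond `(κ, u)` with `|gaugeWt Lc y κ u| = 1`:
  `∃ α y′, (y′ = y ∨ y′ = y − e_α) ∧ (Lc^{d+1})⁻¹ ≤ 2(d+1)·|T_m α y′ κ u|`, `T_m = respStepBm (toSite rr) Lc (Lc^m) (Lc^(m+1))` — THE DRESSED ONE-STEP LEG IS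
  `≥ (Lc^{d+1})⁻¹∕(2(d+1))` IN SUP OVER THE `2(d+1)` ADJACENT COARSE SOURCES ON EVERY SEAM BOND, LEVEL-FREE.
* §3 **`exists_abs_legChain_ge_at_seam`**: the same for the depth-`k` chain at composite blocking `L = Lc^{k+1}`: `(Lc^{(d+1)(k+1)})⁻¹ ≤ 2(d+1)·|legChain … m k α y′ κ u|`
  on every `L`-seam bond of the block `y` — leaf-12's envelope `(Lc^{d+1})^{−(k+1)}` is attained there up to `2(d+1)`.
  In §2 also **`le_of_respStepBm_sup`** (the ratio, displayed): if `|T_m α y′ κ u| ≤ CT` for all entries then `(Lc^{d+1})⁻¹ ≤ 2(d+1)·CT` — ANY uniform sup of the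
  dressed one-step family is `≥ (Lc^{d+1})⁻¹∕(2(d+1))` (so a sup of the undressed shape `A·(Lc^{d+2})⁻¹` forces `A ≥ Lc∕(2(d+1))`: `le_mul_of_respStepBm_sup_undressedShape`).
* §4 SHARPNESS OF THE DRESSED ENVELOPE's POWER: `abs_gaugeWt_seamBond` (the bond `(0, (L−1)e₀)` exits the block `0`), **`one_le_mul_of_legChain_envelope`** (ANY uniform bound
  `K·(Lc^{(d+1)(k+1)})⁻¹` on the depth-`k` chain has `1 ≤ 2(d+1)·K`), **`pow_le_mul_of_legChain_betterShape`** (one more power of `L = Lc^{k+1}` forces `L ≤ 2(d+1)·K′` — no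
  uniform bound with a better power), **`one_le_eight_mul_of_dressedEnvelope`** (`d = 3`: every witness `(κ₀, K)` of leaf-12's `DressedLegEnvelope.exists_legChain_envelope`
  conclusion has `1 ≤ 8·K` — the envelope's power `(Lc^4)^{−(k+1)}` is SHARP).
* §5 THE UNDRESSED COMPANION (ALT3-COST's object): **`exists_sum_respStep_sub_eq_dz`** — the undressed `respStep M N′` obeys a coarse Ward law too, with datum
  `dz (blockSum M g_y)` for a SMOOTH potential (an5's elementary exact response, contour-summed; engine R23 (D): seam value `≈ 1.7∕Lc ×` the sharp one), and
  **`exists_abs_ge_of_ward_potential`** — §1's pigeonhole at a general exact datum: the lower bound is the potential's one-bond gradient, full jump `(Lc^{d+1})⁻¹` for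
  the dressed legs, smooth for the undressed ones (how they escape); **`exists_codiff₁_push₃_respStep_row_eq`** — THE KERNEL-ROW GAUGE LAW OF A `U`-PUSH (ALT3-COST
  (N-c)'s core, first refusal named leaf-01): the coarse row codifferential of `push₃ U_m r′ w S` is the push with the SMOOTHED gauge `dz (blockSum (Lc^m) (G y))` as
  left leg (PART 1 §2's socket at `c = 1`; the datum is exact but NOT block-local — ALT3-COST's risk (R1), displayed).
* §6 HYPOTHESIS-FREE FORMS BY NAME: `codiff₁_push₃_chain_row_eq'`, `tsum_dz_mul_push₃_chain_row_eq'`, `codiff₁_push₃_literal_row_eq'` — PART 1 §4 ∕ PART 2 §3, §5 with the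
  levelwise leg hypotheses `hK` ∕ `hD` DISCHARGED by leaf-03 g41's `RespStepBmDecompPsi.decays_KStepUnit_levels` ∕ `legDecay_respStep_levels_holds` (an4's
  `decays_KInvStep` + asym1's `decays_unitK`): the literal's row codifferential laws hold with NO displayed leg hypothesis (only `LocStencil S`, `δ > 0`, in-block root).
Identities + pigeonhole only: NO size of the undressed potential's gradient is asserted (the `≈ 1.7∕Lc` is the engine's), NO upper bound, NO table; the located reading (the dressed∕undressed seam ratio `≍ Lc`, hence the
dressed boundary tower's extra `Lc²` per level over the undressed one) combines §2 with (N1), which is NOT imported or restated here.  Decides nothing about (Q-R) ∕ (DIV) ∕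
(DL) ∕ K-LL-4′ as binders (it prices a mechanism, it refutes no displayed hypothesis); NEVER «G-an2-4 closed» as (CONV-C); NOT D1, NOT `BetaPertH`, NOT continuum, NOT
Clay; not in print — our bookkeeping.  2026-08-22; no existing file touched.
-/

noncomputable section

open Finset
open scoped BigOperators
open Literature.MathematicalPhysics.QuantumFieldTheory
open Literature.MathematicalPhysics.QuantumFieldTheory.Balaban1983to89
open Literature.MathematicalPhysics.QuantumFieldTheory.Balaban1983to89.Beta
open AffineAveraging (Form0 box toSite dz codiff₁ blockSum)
open AveragingContours (blk)
open BalabanCompositeJets (respStep)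
open Summit.QuantumFields.BalabanUV.Beta.KernelWardRelative (gaugeWt)
open Summit.QuantumFields.BalabanUV.Beta.GAN24.Push4Iter (legChain)
open Summit.QuantumFields.BalabanUV.Beta.GAN24.RespStepBm (respStepBm)
open Summit.QuantumFields.BalabanUV.Beta.GAN24.RespStepBmDecompExact (respStepBmSeq)
open Summit.QuantumFields.BalabanUV.Beta.GAN24.Push3 (push₃)
open Summit.QuantumFields.BalabanUV.Beta.GAN24.PushRowCoarseWard (sum_respStepBm_sub_eq_gaugeWt codiff₁_push₃_row_eq_smul_of_ward)
open Summit.QuantumFields.BalabanUV.Beta.GAN24.PushRowCoarseWardChain (sum_legChain_sub_eq_gaugeWt sum_sub_eq_legAct_dz_indicator)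
open Summit.QuantumFields.BalabanUV.Beta.GAN24.RespStepBmDecompLegs (legAct legAct_apply exists_legL1_respStep)
open Summit.QuantumFields.BalabanUV.Beta.GAN24.RespStepBmGaugeStep (sum_tsum_dz_mul_respStep_eq exists_contourSum_exactResponse_tsum_eq_dz)

namespace Summit.QuantumFields.BalabanUV.Beta.GAN24.DressedLegSeamLowerBound

variable {d : ℕ}

/-! ## §1 Pigeonhole on the Ward identity; the seam bonds of a block -/
/-- [folklore] **PIGEONHOLE**: if `Σ_{α : Fin (d+1)} (a α − b α) = c` then one of the `2(d+1)` numbers `a α`, `b α` is at least `|c|∕(2(d+1))` in absolute value. -/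
theorem exists_abs_ge_of_sum_sub_eq {a b : Fin (d + 1) → ℝ} {c : ℝ} (h : ∑ α, (a α - b α) = c) :
    ∃ α, |c| ≤ 2 * ((d : ℝ) + 1) * |a α| ∨ |c| ≤ 2 * ((d : ℝ) + 1) * |b α| := by
  by_contra hne
  simp only [not_exists, not_or, not_le] at hne
  have hlt : ∀ α, |a α - b α| < |c| / ((d : ℝ) + 1) := by
    intro α
    obtain ⟨ha, hb⟩ := hne α
    have hd : (0 : ℝ) < (d : ℝ) + 1 := by positivity
    have ha' : |a α| < |c| / (2 * ((d : ℝ) + 1)) := by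
      rw [lt_div_iff₀ (by positivity)]; linarith [mul_comm (2 * ((d : ℝ) + 1)) |a α|]
    have hb' : |b α| < |c| / (2 * ((d : ℝ) + 1)) := by
      rw [lt_div_iff₀ (by positivity)]; linarith [mul_comm (2 * ((d : ℝ) + 1)) |b α|]
    calc |a α - b α| ≤ |a α| + |b α| := abs_sub _ _
      _ < |c| / (2 * ((d : ℝ) + 1)) + |c| / (2 * ((d : ℝ) + 1)) := add_lt_add ha' hb'
      _ = |c| / ((d : ℝ) + 1) := by field_simp; ring
  have hsum : |c| ≤ ∑ α : Fin (d + 1), |a α - b α| := by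
    rw [← h]; exact Finset.abs_sum_le_sum_abs _ _
  have hlt' : ∑ α : Fin (d + 1), |a α - b α| < ∑ _α : Fin (d + 1), |c| / ((d : ℝ) + 1) :=
    Finset.sum_lt_sum_of_nonempty Finset.univ_nonempty fun α _ => hlt α
  rw [Finset.sum_const, Finset.card_univ, Fintype.card_fin, nsmul_eq_mul] at hlt'
  have e : ((d + 1 : ℕ) : ℝ) * (|c| / ((d : ℝ) + 1)) = |c| := by push_cast; field_simp
  rw [e] at hlt'
  exact absurd (hsum.trans_lt hlt') (lt_irrefl _)
/-- [folklore] The pure-gauge weight of a block is bounded by one. -/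
theorem abs_gaugeWt_le_one (L : ℕ) (y : Fin (d + 1) → ℤ) (κ : Fin (d + 1)) (u : Fin (d + 1) → ℤ) : |gaugeWt L y κ u| ≤ 1 := by
  simp only [KernelWardRelative.gaugeWt]
  split_ifs <;> norm_num
/-- [folklore] **THE SEAM BONDS OF THE BLOCK `y`**: `|gaugeWt L y κ u| = 1` iff EXACTLY ONE of the two endpoint blocks `blk L u`, `blk L (u + e_κ)` is `y`
(the bond crosses `∂B_L(y)`); otherwise the weight is `0`. -/
theorem abs_gaugeWt_eq_one_iff (L : ℕ) (y : Fin (d + 1) → ℤ) (κ : Fin (d + 1)) (u : Fin (d + 1) → ℤ) :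
    |gaugeWt L y κ u| = 1 ↔ (blk L (u + B6BondElimination.unitVec κ) = y ↔ blk L u ≠ y) := by
  simp only [KernelWardRelative.gaugeWt]
  by_cases h1 : blk L (u + B6BondElimination.unitVec κ) = y <;> by_cases h2 : blk L u = y <;> simp [h1, h2]
/-- NOT IN PRINT; OUR BOOKKEEPING.  **GENERIC FORM — ANY COARSE-GAUGE-COVARIANT LEG FAMILY IS `≥ |c|∕(2(d+1))` ON THE SEAMS**: if a leg family `l` obeys the coarse
Ward law `Σ_α (l α (y − e_α) κ u − l α y κ u) = c·gaugeWt L y κ u` at the block `y` (the socket shape of an1's `hH`; instances: d1-leaf-07's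
`KernelWardHColumnWall.colH_ward_KInvStep_all`, an2's `CombChartHColumnWard.colH_ward_coDressKAt_of_ward ∕ colH_ward_GcombSh`, PART 1 §3, PART 2 §2), then on every
seam bond `(κ, u)` of `B_L(y)` some entry `l α y′ κ u`, `y′ ∈ {y, y − e_α}`, has `|c| ≤ 2(d+1)·|l α y′ κ u|` — whatever projector or chart realises the law. -/
theorem exists_abs_ge_at_seam_of_ward {l : Fin (d + 1) → (Fin (d + 1) → ℤ) → Fin (d + 1) → (Fin (d + 1) → ℤ) → ℝ} {c : ℝ} {L : ℕ}
    {y : Fin (d + 1) → ℤ} {κ : Fin (d + 1)} {u : Fin (d + 1) → ℤ}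
    (hW : ∑ α, (l α (y - AffineAveraging.unitVec α) κ u - l α y κ u) = c * gaugeWt L y κ u) (hseam : |gaugeWt L y κ u| = 1) :
    ∃ (α : Fin (d + 1)) (y' : Fin (d + 1) → ℤ), (y' = y ∨ y' = y - AffineAveraging.unitVec α) ∧ |c| ≤ 2 * ((d : ℝ) + 1) * |l α y' κ u| := by
  have hc : |c * gaugeWt L y κ u| = |c| := by rw [abs_mul, hseam, mul_one]
  obtain ⟨α, hα | hα⟩ := exists_abs_ge_of_sum_sub_eq hW
  · exact ⟨α, y - AffineAveraging.unitVec α, Or.inr rfl, by rwa [hc] at hα⟩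
  · exact ⟨α, y, Or.inl rfl, by rwa [hc] at hα⟩

/-! ## §2 The dressed one-step family on the seams -/
section OneStep
variable {Lc : ℕ} [NeZero Lc] {rr : Fin (d + 1) → ℕ}
/-- NOT IN PRINT; OUR BOOKKEEPING (PART 1 §3 `sum_respStepBm_sub_eq_gaugeWt` ⨾ §1).  **THE DRESSED ONE-STEP RESPONSE FAMILY IS `≥ (Lc^{d+1})⁻¹∕(2(d+1))` ON EVERY SEAM
BOND, LEVEL-FREE**: for every in-block root, level `m`, block `y` and bond `(κ, u)` crossing `∂B_{Lc}(y)` (`|gaugeWt Lc y κ u| = 1`) there are a direction `α` and a coarse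
source `y′ ∈ {y, y − e_α}` with `(Lc^{d+1})⁻¹ ≤ 2(d+1)·|T_m α y′ κ u|`, `T_m = respStepBm (toSite rr) Lc (Lc^m) (Lc^(m+1))` — the block holonomy that the coarse
Ward law books on the seams (the OWNER's R22 (1) ∕ C-1 located mechanism, as a kernel statement about the dressed legs alone). -/
theorem exists_abs_respStepBm_ge_at_seam (hrr : rr ∈ box (d + 1) Lc) (m : ℕ) {y : Fin (d + 1) → ℤ} {κ : Fin (d + 1)} {u : Fin (d + 1) → ℤ}
    (hseam : |gaugeWt Lc y κ u| = 1) :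
    ∃ (α : Fin (d + 1)) (y' : Fin (d + 1) → ℤ), (y' = y ∨ y' = y - AffineAveraging.unitVec α) ∧
      (((Lc : ℝ) ^ (d + 1))⁻¹) ≤ 2 * ((d : ℝ) + 1) * |respStepBm (toSite rr) Lc (Lc ^ m) (Lc ^ (m + 1)) α y' κ u| := by
  obtain ⟨α, y', hy', hle⟩ := exists_abs_ge_at_seam_of_ward (sum_respStepBm_sub_eq_gaugeWt (d := d) hrr m y κ u) hseam
  exact ⟨α, y', hy', by rwa [abs_of_nonneg (by positivity : (0 : ℝ) ≤ ((Lc : ℝ) ^ (d + 1))⁻¹)] at hle⟩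
/-- NOT IN PRINT; OUR BOOKKEEPING.  **EVERY UNIFORM SUP OF THE DRESSED ONE-STEP FAMILY IS `≥ (Lc^{d+1})⁻¹∕(2(d+1))`** (one seam bond displayed). -/
theorem le_of_respStepBm_sup (hrr : rr ∈ box (d + 1) Lc) (m : ℕ) {CT : ℝ}
    (hT : ∀ α y' κ' u', |respStepBm (toSite rr) Lc (Lc ^ m) (Lc ^ (m + 1)) α y' κ' u'| ≤ CT)
    {y : Fin (d + 1) → ℤ} {κ : Fin (d + 1)} {u : Fin (d + 1) → ℤ} (hseam : |gaugeWt Lc y κ u| = 1) :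
    (((Lc : ℝ) ^ (d + 1))⁻¹) ≤ 2 * ((d : ℝ) + 1) * CT := by
  obtain ⟨α, y', -, hle⟩ := exists_abs_respStepBm_ge_at_seam hrr m hseam
  exact hle.trans (mul_le_mul_of_nonneg_left (hT α y' κ u) (by positivity))
/-- NOT IN PRINT; OUR BOOKKEEPING.  **THE RATIO TO AN UNDRESSED-SHAPED SUP IS LINEAR IN `Lc`**: a sup of the UNDRESSED shape `A·(Lc^{d+2})⁻¹` ((N1)'s shape, asserted for NO
family here) on the dressed family forces `Lc ≤ 2(d+1)·A` (the engine's `max|Π_bm wH| ∕ max|wH| ≈ 0.7·Lc`). -/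
theorem le_mul_of_respStepBm_sup_undressedShape (hrr : rr ∈ box (d + 1) Lc) (m : ℕ) {A : ℝ}
    (hT : ∀ α y' κ' u', |respStepBm (toSite rr) Lc (Lc ^ m) (Lc ^ (m + 1)) α y' κ' u'| ≤ A * (((Lc : ℝ) ^ (d + 2))⁻¹))
    {y : Fin (d + 1) → ℤ} {κ : Fin (d + 1)} {u : Fin (d + 1) → ℤ} (hseam : |gaugeWt Lc y κ u| = 1) :
    (Lc : ℝ) ≤ 2 * ((d : ℝ) + 1) * A := by
  have hLc : (0 : ℝ) < (Lc : ℝ) := by exact_mod_cast Nat.pos_of_ne_zero (NeZero.ne Lc)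
  have h := le_of_respStepBm_sup hrr m hT hseam
  -- `(Lc^{d+1})⁻¹ ≤ 2(d+1)·A·(Lc^{d+2})⁻¹`  ⟹  `Lc ≤ 2(d+1)·A`
  have hpos : (0 : ℝ) < (Lc : ℝ) ^ (d + 2) := by positivity
  have hLc0 : (Lc : ℝ) ≠ 0 := hLc.ne'
  have e : (((Lc : ℝ) ^ (d + 1))⁻¹) * (Lc : ℝ) ^ (d + 2) = Lc := by
    field_simp
    ring
  calc (Lc : ℝ) = (((Lc : ℝ) ^ (d + 1))⁻¹) * (Lc : ℝ) ^ (d + 2) := e.symm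
    _ ≤ (2 * ((d : ℝ) + 1) * (A * (((Lc : ℝ) ^ (d + 2))⁻¹))) * (Lc : ℝ) ^ (d + 2) := mul_le_mul_of_nonneg_right h hpos.le
    _ = 2 * ((d : ℝ) + 1) * A := by field_simp

end OneStep
/-! ## §3 The depth-`k` chain on the seams of the composite blocks -/
section Chain
variable {Lc : ℕ} [NeZero Lc] {rr : Fin (d + 1) → ℕ}
/-- NOT IN PRINT; OUR BOOKKEEPING (PART 2 §2 `sum_legChain_sub_eq_gaugeWt` ⨾ §1).  **THE DEPTH-`k` DRESSED CHAIN IS `≥ (Lc^{(d+1)(k+1)})⁻¹∕(2(d+1))` ON EVERY SEAM BOND OF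
THE COMPOSITE BLOCK LATTICE `L = Lc^{k+1}`**: for every in-block root, base level `m`, depth `k`, block `y` and bond `(κ, u)` with `|gaugeWt (Lc^(k+1)) y κ u| = 1` there
are `α` and `y′ ∈ {y, y − e_α}` with `(Lc^{(d+1)(k+1)})⁻¹ ≤ 2(d+1)·|legChain (respStepBmSeq (toSite rr) Lc) m k α y′ κ u|` — leaf-12's dressed envelope
`(Lc^{d+1})^{−(k+1)}` (`DressedLegEnvelope.exists_legChain_envelope`) is attained at the seams up to `2(d+1)`, at every depth. -/
theorem exists_abs_legChain_ge_at_seam (hrr : rr ∈ box (d + 1) Lc) (m k : ℕ) {y : Fin (d + 1) → ℤ} {κ : Fin (d + 1)} {u : Fin (d + 1) → ℤ}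
    (hseam : |gaugeWt (Lc ^ (k + 1)) y κ u| = 1) :
    ∃ (α : Fin (d + 1)) (y' : Fin (d + 1) → ℤ), (y' = y ∨ y' = y - AffineAveraging.unitVec α) ∧
      (((Lc : ℝ) ^ ((d + 1) * (k + 1)))⁻¹) ≤ 2 * ((d : ℝ) + 1) * |legChain (respStepBmSeq (toSite rr) Lc) m k α y' κ u| := by
  obtain ⟨α, y', hy', hle⟩ := exists_abs_ge_at_seam_of_ward (sum_legChain_sub_eq_gaugeWt (d := d) hrr m k y κ u) hseam
  exact ⟨α, y', hy', by rwa [abs_of_nonneg (by positivity : (0 : ℝ) ≤ ((Lc : ℝ) ^ ((d + 1) * (k + 1)))⁻¹)] at hle⟩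
/-- NOT IN PRINT; OUR BOOKKEEPING.  **EVERY UNIFORM SUP OF THE DEPTH-`k` CHAIN IS `≥ (Lc^{(d+1)(k+1)})⁻¹∕(2(d+1))`** (one seam bond displayed). -/
theorem le_of_legChain_sup (hrr : rr ∈ box (d + 1) Lc) (m k : ℕ) {CT : ℝ}
    (hT : ∀ α y' κ' u', |legChain (respStepBmSeq (toSite rr) Lc) m k α y' κ' u'| ≤ CT)
    {y : Fin (d + 1) → ℤ} {κ : Fin (d + 1)} {u : Fin (d + 1) → ℤ} (hseam : |gaugeWt (Lc ^ (k + 1)) y κ u| = 1) :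
    (((Lc : ℝ) ^ ((d + 1) * (k + 1)))⁻¹) ≤ 2 * ((d : ℝ) + 1) * CT := by
  obtain ⟨α, y', -, hle⟩ := exists_abs_legChain_ge_at_seam hrr m k hseam
  exact hle.trans (mul_le_mul_of_nonneg_left (hT α y' κ u) (by positivity))

end Chain
/-! ## §4 Sharpness of the dressed envelope's power: any bound of the shape `K·L^{−(d+1)}` on the chain has `K ≥ 1∕(2(d+1))` -/
section Sharp
variable {Lc : ℕ} [NeZero Lc] {rr : Fin (d + 1) → ℕ}
/-- [folklore] **A SEAM BOND OF THE BLOCK `0` AT BLOCKING `L ≥ 1`**: with `u = (L − 1)·e₀` the bond `(0, u)` exits the block `0`: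
`|gaugeWt L 0 0 u| = 1` (integer division: `(L−1)∕L = 0`, `L∕L = 1`). -/
theorem abs_gaugeWt_seamBond (L : ℕ) (hL : 1 ≤ L) :
    |gaugeWt (d := d) L 0 0 (fun i => if i = 0 then ((L : ℤ) - 1) else 0)| = 1 := by
  have hL0 : (L : ℤ) ≠ 0 := by exact_mod_cast Nat.one_le_iff_ne_zero.1 hL
  have hblk0 : blk L (fun i : Fin (d + 1) => if i = 0 then ((L : ℤ) - 1) else 0) = 0 := by
    funext i
    simp only [AveragingContours.blk, Pi.zero_apply]
    split_ifs
    · exact Int.ediv_eq_zero_of_lt (by omega) (by omega)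
    · simp
  have hblk1 : blk L ((fun i : Fin (d + 1) => if i = 0 then ((L : ℤ) - 1) else 0) + B6BondElimination.unitVec 0) ≠ 0 := by
    intro h
    have h0 := congrFun h 0
    simp only [AveragingContours.blk, Pi.add_apply, B6BondElimination.unitVec_apply, if_true, Pi.zero_apply, sub_add_cancel,
      Int.ediv_self hL0] at h0
    exact one_ne_zero h0
  rw [abs_gaugeWt_eq_one_iff]
  exact ⟨fun h => absurd h hblk1, fun _ => by exact absurd hblk0 (fun h' => by simp_all)⟩
/-- NOT IN PRINT; OUR BOOKKEEPING.  **ANY UNIFORM BOUND OF THE DRESSED-ENVELOPE SHAPE `K·(Lc^{(d+1)(k+1)})⁻¹` ON THE DEPTH-`k` CHAIN HAS `1 ≤ 2(d+1)·K`** (the seam bond of §4's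
first lemma at `L = Lc^{k+1}` fed to §3): the power `L^{−(d+1)}` of leaf-12's dressed envelope cannot come with a small constant, and NO bound with a higher power of `L`
can hold uniformly (next lemma). -/
theorem one_le_mul_of_legChain_envelope (hrr : rr ∈ box (d + 1) Lc) (m k : ℕ) {K : ℝ}
    (hK : ∀ α y' κ' u', |legChain (respStepBmSeq (toSite rr) Lc) m k α y' κ' u'| ≤ K * (((Lc : ℝ) ^ ((d + 1) * (k + 1)))⁻¹)) :
    1 ≤ 2 * ((d : ℝ) + 1) * K := by
  have hL : 1 ≤ Lc ^ (k + 1) := Nat.one_le_iff_ne_zero.2 (pow_ne_zero _ (NeZero.ne Lc))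
  have hseam := abs_gaugeWt_seamBond (d := d) (Lc ^ (k + 1)) hL
  have h := le_of_legChain_sup hrr m k hK hseam
  have hLc : (0 : ℝ) < (Lc : ℝ) := by exact_mod_cast Nat.pos_of_ne_zero (NeZero.ne Lc)
  have hpos : (0 : ℝ) < ((Lc : ℝ) ^ ((d + 1) * (k + 1)))⁻¹ := by positivity
  have h' : (((Lc : ℝ) ^ ((d + 1) * (k + 1)))⁻¹) * 1 ≤ (((Lc : ℝ) ^ ((d + 1) * (k + 1)))⁻¹) * (2 * ((d : ℝ) + 1) * K) := by
    rw [mul_one]; linarith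
  exact le_of_mul_le_mul_left h' hpos

/-- NOT IN PRINT; OUR BOOKKEEPING.  **NO BETTER POWER**: a uniform bound `K′·(Lc^{(d+1)(k+1)})⁻¹·(Lc^(k+1))⁻¹` (one more power of `L = Lc^{k+1}`) forces `L ≤ 2(d+1)·K′`. -/
theorem pow_le_mul_of_legChain_betterShape (hrr : rr ∈ box (d + 1) Lc) (m k : ℕ) {K' : ℝ}
    (hK : ∀ α y' κ' u', |legChain (respStepBmSeq (toSite rr) Lc) m k α y' κ' u'|
      ≤ K' * (((Lc : ℝ) ^ ((d + 1) * (k + 1)))⁻¹) * (((Lc : ℝ) ^ (k + 1))⁻¹)) :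
    ((Lc : ℝ) ^ (k + 1)) ≤ 2 * ((d : ℝ) + 1) * K' := by
  have hLpos : (0 : ℝ) < (Lc : ℝ) ^ (k + 1) := by
    have : (0 : ℝ) < (Lc : ℝ) := by exact_mod_cast Nat.pos_of_ne_zero (NeZero.ne Lc)
    positivity
  have h := one_le_mul_of_legChain_envelope hrr m k (K := K' * (((Lc : ℝ) ^ (k + 1))⁻¹)) (fun α y' κ' u' => by
    have := hK α y' κ' u'; linarith [mul_right_comm K' (((Lc : ℝ) ^ ((d + 1) * (k + 1)))⁻¹) (((Lc : ℝ) ^ (k + 1))⁻¹)])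
  -- `1 ≤ 2(d+1)·K′·L⁻¹` ⟹ `L ≤ 2(d+1)·K′`
  have h2 : ((Lc : ℝ) ^ (k + 1)) * 1 ≤ ((Lc : ℝ) ^ (k + 1)) * (2 * ((d : ℝ) + 1) * (K' * (((Lc : ℝ) ^ (k + 1))⁻¹))) :=
    mul_le_mul_of_nonneg_left h hLpos.le
  rw [mul_one] at h2
  calc ((Lc : ℝ) ^ (k + 1)) ≤ ((Lc : ℝ) ^ (k + 1)) * (2 * ((d : ℝ) + 1) * (K' * (((Lc : ℝ) ^ (k + 1))⁻¹))) := h2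
    _ = 2 * ((d : ℝ) + 1) * K' := by field_simp

/-- NOT IN PRINT; OUR BOOKKEEPING (leaf-12's `DressedLegEnvelope.exists_legChain_envelope`, `d = 3`, `2 ≤ Lc` ⨾ the previous lemmas).  **leaf-12's DRESSED ENVELOPE
`|legChain (respStepBmSeq ρ Lc) m k| ≤ K·(Lc^{4(k+1)})⁻¹·e^{−κ₀‖quo − z‖_∞}` IS SHARP IN THE POWER OF `L = Lc^{k+1}`**: every witness pair `(κ₀, K)` of its conclusion has
`1 ≤ 8·K`. -/
theorem one_le_eight_mul_of_dressedEnvelope {Lc : ℕ} [NeZero Lc] {κ₀ K : ℝ} (hκ₀ : 0 ≤ κ₀)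
    (hK : ∀ (rr : Fin (3 + 1) → ℕ), rr ∈ box (3 + 1) Lc →
      ∀ (m k : ℕ) (μ : Fin (3 + 1)) (z : Fin (3 + 1) → ℤ) (κ : Fin (3 + 1)) (u : Fin (3 + 1) → ℤ),
        |legChain (respStepBmSeq (d := 3) (toSite rr) Lc) m k μ z κ u|
          ≤ K * ((Lc : ℝ) ^ (4 * (k + 1)))⁻¹ * Real.exp (-(κ₀ * B4ContourShift.supNorm (LatticeForm.quo (Lc ^ (k + 1)) u - z)))) :
    1 ≤ 8 * K := by
  have hrr : (fun _ : Fin (3 + 1) => (0 : ℕ)) ∈ box (3 + 1) Lc := by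
    simp only [AffineAveraging.box, Fintype.mem_piFinset, Finset.mem_range]
    exact fun _ => Nat.pos_of_ne_zero (NeZero.ne Lc)
  have hLc : (0 : ℝ) < (Lc : ℝ) := by exact_mod_cast Nat.pos_of_ne_zero (NeZero.ne Lc)
  have hK0 : 0 ≤ K := by
    have h := (abs_nonneg _).trans (hK _ hrr 0 0 0 0 0 0)
    have he : (0 : ℝ) < ((Lc : ℝ) ^ (4 * (0 + 1)))⁻¹ *
        Real.exp (-(κ₀ * B4ContourShift.supNorm (LatticeForm.quo (Lc ^ (0 + 1)) (0 : Fin (3 + 1) → ℤ) - 0))) := by positivity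
    rw [mul_assoc] at h
    exact (mul_nonneg_iff_of_pos_right he).mp h
  have hK' : ∀ α y' κ' u', |legChain (respStepBmSeq (d := 3) (toSite fun _ : Fin (3 + 1) => (0 : ℕ)) Lc) 0 0 α y' κ' u'|
      ≤ K * (((Lc : ℝ) ^ ((3 + 1) * (0 + 1)))⁻¹) := by
    intro α y' κ' u'
    refine (hK _ hrr 0 0 α y' κ' u').trans ?_
    have he1 : Real.exp (-(κ₀ * B4ContourShift.supNorm (LatticeForm.quo (Lc ^ (0 + 1)) u' - y'))) ≤ 1 :=
      Real.exp_le_one_iff.2 (by nlinarith [B4ContourShift.supNorm_nonneg (LatticeForm.quo (Lc ^ (0 + 1)) u' - y')])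
    have e : ((Lc : ℝ) ^ (4 * (0 + 1)))⁻¹ = (((Lc : ℝ) ^ ((3 + 1) * (0 + 1)))⁻¹) := by norm_num
    rw [← e]
    calc K * ((Lc : ℝ) ^ (4 * (0 + 1)))⁻¹ * Real.exp (-(κ₀ * B4ContourShift.supNorm (LatticeForm.quo (Lc ^ (0 + 1)) u' - y')))
        ≤ K * ((Lc : ℝ) ^ (4 * (0 + 1)))⁻¹ * 1 := mul_le_mul_of_nonneg_left he1 (by positivity)
      _ = K * ((Lc : ℝ) ^ (4 * (0 + 1)))⁻¹ := mul_one _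
  have h := one_le_mul_of_legChain_envelope (d := 3) hrr 0 0 hK'
  norm_num at h
  linarith

end Sharp
/-! ## §5 The undressed companion (ALT3-COST's «smoothed gauge», the OWNER g31's R23 (D)∕(E)(iii)): the UNDRESSED response family is coarse-gauge-covariant
too, but its Ward datum is the gradient of a SMOOTH potential — the block contour-sum potential of an5's elementary exact response — not of the block-sharp
`(Lc^{d+1})⁻¹·𝟙_{B(y)}`; so §1's seam bound does not bite on it -/

section Undressed
variable {N' : ℕ} [NeZero N']

open Classical in
/-- NOT IN PRINT; OUR BOOKKEEPING (PART 2 §1 `sum_sub_eq_legAct_dz_indicator` ⨾ the OWNER g12∕leaf-12's `RespStepBmGaugeStep.sum_tsum_dz_mul_respStep_eq` +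
`exists_contourSum_exactResponse_tsum_eq_dz` — an5's flatness of the elementary exact response + the lattice Poincaré lemma).  **THE UNDRESSED RESPONSE FAMILY's
COARSE WARD DATUM IS AN EXACT FORM WITH A SMOOTH POTENTIAL**: for every read-out blocking `M`, level `N′` and coarse block `y` there is a potential `g_y` with
`(κ, u) ↦ Σ_α (respStep M N′ α (y − e_α) κ u − respStep M N′ α y κ u) = dz (blockSum M g_y)` — the `M`-block contour sums of an5's minimiser response to the
elementary exact datum `dᵀδ_y` (engine R23 (D): seam value `≈ 1.7∕Lc ×` the sharp datum's).  The pigeonhole §1 then bounds the undressed legs below only by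
`|dz (blockSum M g_y) κ u|∕(2(d+1))` — the gradient of a smooth potential across ONE bond — which is how they escape the seam bound (they obey no law with the
SHARP datum `c·gaugeWt`).  ALT3-COST's target spec «kernel legs responding by the smoothed gauge, not the block-sharp one» is this object. -/
theorem exists_sum_respStep_sub_eq_dz (M : ℕ) (y : Fin (d + 1) → ℤ) :
    ∃ g : Form0 (d + 1) ℝ, (fun κ u => ∑ α, (respStep (d := d) M N' α (y - AffineAveraging.unitVec α) κ u - respStep (d := d) M N' α y κ u))
      = dz (blockSum M g) := by
  have hψs : Summable (fun z : Fin (d + 1) → ℤ => if z = y then (1 : ℝ) else 0) :=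
    summable_of_ne_finset_zero (s := {y}) (fun z hz => by
      rw [Finset.mem_singleton] at hz
      simp only [if_neg hz])
  obtain ⟨g, hg⟩ := exists_contourSum_exactResponse_tsum_eq_dz (N' := N') (d := d) M hψs
  refine ⟨g, ?_⟩
  funext κ u
  rw [sum_sub_eq_legAct_dz_indicator, legAct_apply, sum_tsum_dz_mul_respStep_eq hψs M κ u, hg]

/-- NOT IN PRINT; OUR BOOKKEEPING (§1 at the datum `dz Φ`).  **THE GENERIC LOWER BOUND BY THE WARD POTENTIAL's GRADIENT**: if `Σ_α (l α (y − e_α) κ u − l α y κ u) = dz Φ κ u`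
then some entry `l α y′ κ u`, `y′ ∈ {y, y − e_α}`, has `|dz Φ κ u| ≤ 2(d+1)·|l α y′ κ u|` — for the dressed legs `Φ = (Lc^{d+1})⁻¹·𝟙_{B(y)}` jumps by the full
`(Lc^{d+1})⁻¹` across each seam (§2), for the undressed ones `Φ = blockSum M g_y` is smooth (the previous lemma), and the bound is the potential's one-bond gradient. -/
theorem exists_abs_ge_of_ward_potential {l : Fin (d + 1) → (Fin (d + 1) → ℤ) → Fin (d + 1) → (Fin (d + 1) → ℤ) → ℝ} {Φ : Form0 (d + 1) ℝ}
    {y : Fin (d + 1) → ℤ} {κ : Fin (d + 1)} {u : Fin (d + 1) → ℤ}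
    (hW : ∑ α, (l α (y - AffineAveraging.unitVec α) κ u - l α y κ u) = dz Φ κ u) :
    ∃ (α : Fin (d + 1)) (y' : Fin (d + 1) → ℤ), (y' = y ∨ y' = y - AffineAveraging.unitVec α) ∧ |dz Φ κ u| ≤ 2 * ((d : ℝ) + 1) * |l α y' κ u| := by
  obtain ⟨α, hα | hα⟩ := exists_abs_ge_of_sum_sub_eq hW
  · exact ⟨α, y - AffineAveraging.unitVec α, Or.inr rfl, hα⟩
  · exact ⟨α, y, Or.inl rfl, hα⟩

/-- NOT IN PRINT; OUR BOOKKEEPING (the previous lemma ⨾ PART 1 §2 `codiff₁_push₃_row_eq_smul_of_ward` with `c = 1`).  **THE KERNEL-ROW GAUGE LAW OF A PUSH THROUGH THE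
UNDRESSED ONE-STEP LEG** (the core of the OWNER g31's ALT3-COST (N-c) «PushKernelGaugeLaw», `gen31/ALT3-COST.md` v0 §4, first refusal named leaf-01): for the literal's
undressed one-step family `U_m = respStep (Lc^m) (Lc^(m+1))` as LEFT leg, arbitrary right∕table legs on the summable class and `LocStencil S Cs δ` (`δ > 0`), there is a
family of SMOOTH potentials `G y` (one per coarse block, §5's) with, for every `(κ′, u′)`, `(z′, b)`, `y`, `α₀`,
`codiff₁ (α x ↦ push₃ U_m r′ w S κ′ u′ x z′ (inl α) b) y = push₃ (fun _ x κ u ↦ dz (blockSum (Lc^m) (G x)) κ u) r′ w S κ′ u′ y z′ (inl α₀) b`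
— the coarse ROW codifferential of a `U`-pushed letter is the push with the SMOOTHED gauge `dz (blockSum (Lc^m) (G y))` as left leg (located risk (R1) of ALT3-COST
displayed honestly: the datum is an exact form but NOT block-local; no size asserted). -/
theorem exists_codiff₁_push₃_respStep_row_eq {Lc : ℕ} [NeZero Lc] (m : ℕ)
    {r' w : Fin (d + 1) → (Fin (d + 1) → ℤ) → Fin (d + 1) → (Fin (d + 1) → ℤ) → ℝ} {Cw : ℝ}
    {S : Fin (d + 1) → (Fin (d + 1) → ℤ) → ExpKernelCalculus.MKer (d + 1) (OneStepResolventKernel.Fib d)} {Cs δ : ℝ}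
    (hrs : ∀ β z' κ, Summable fun z => r' β z' κ z) (hw : ∀ κ' u' κ u, |w κ' u' κ u| ≤ Cw)
    (hS : OneStepResolventKernel.LocStencil S Cs δ) (hδ : 0 < δ)
    (κ' : Fin (d + 1)) (u' z' : Fin (d + 1) → ℤ) (α₀ : Fin (d + 1)) (b : OneStepResolventKernel.Fib d) :
    ∃ G : (Fin (d + 1) → ℤ) → Form0 (d + 1) ℝ, ∀ y,
      codiff₁ (fun α x => push₃ (respStep (d := d) (Lc ^ m) (Lc ^ (m + 1))) r' w S κ' u' x z' (Sum.inl α) b) y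
        = push₃ (fun _ x κ u => dz (blockSum (Lc ^ m) (G x)) κ u) r' w S κ' u' y z' (Sum.inl α₀) b := by
  classical
  have hLc : 0 < Lc := Nat.pos_of_ne_zero (NeZero.ne Lc)
  haveI : NeZero (Lc ^ m) := ⟨(pow_pos hLc m).ne'⟩
  obtain ⟨CU, TU, hU⟩ := exists_legL1_respStep (d := d) (M := Lc ^ m) (L := Lc) (N' := Lc ^ (m + 1)) (pow_succ Lc m)
  refine ⟨fun x => Classical.choose (exists_sum_respStep_sub_eq_dz (N' := Lc ^ (m + 1)) (d := d) (Lc ^ m) x), fun y => ?_⟩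
  have hW : ∀ x κ u, ∑ α, (respStep (d := d) (Lc ^ m) (Lc ^ (m + 1)) α (x - AffineAveraging.unitVec α) κ u
      - respStep (d := d) (Lc ^ m) (Lc ^ (m + 1)) α x κ u)
      = 1 * (fun x κ u => dz (blockSum (Lc ^ m) (Classical.choose (exists_sum_respStep_sub_eq_dz (N' := Lc ^ (m + 1)) (d := d) (Lc ^ m) x))) κ u) x κ u := by
    intro x κ u
    have h := Classical.choose_spec (exists_sum_respStep_sub_eq_dz (N' := Lc ^ (m + 1)) (d := d) (Lc ^ m) x)
    have hκu := congrFun (congrFun h κ) u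
    rw [one_mul]
    exact hκu
  rw [codiff₁_push₃_row_eq_smul_of_ward (fun α x' κ x => hU.abs_le α x' κ x) (fun α x' κ => hU.summable α x' κ) hrs hw hS hδ _ 1 hW
    κ' u' y z' α₀ b, one_mul]

end Undressed
/-! ## §6 Hypothesis-free forms BY NAME: the levelwise decay `hD` ∕ `hK` of PARTs 1–3 is leaf-03 g41's `RespStepBmDecompPsi.legDecay_respStep_levels_holds` ∕
`decays_KStepUnit_levels` (an4's `decays_KInvStep` through asym1's `decays_unitK`) — so the row codifferential laws hold for the literal with NO displayed leg hypothesis -/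

section HypFree
variable {Lc : ℕ} [NeZero Lc] {rr : Fin (d + 1) → ℕ}
  {S : Fin (d + 1) → (Fin (d + 1) → ℤ) → ExpKernelCalculus.MKer (d + 1) (OneStepResolventKernel.Fib d)} {Cs δ : ℝ}

/-- NOT IN PRINT; OUR BOOKKEEPING (PART 2 §3 ⨾ `legDecay_respStep_levels_holds`).  **THE DEPTH-`k` ROW CODIFFERENTIAL LAW, NO LEG HYPOTHESIS**: for every in-block root, `m`, `k`,
`LocStencil S Cs δ` (`δ > 0`): `codiff₁ (α x ↦ push₃ T T T S κ′ u′ x z′ (inl α) b) y = (Lc^{(d+1)(k+1)})⁻¹·push₃ (fun _ ↦ gaugeWt (Lc^(k+1))) T T S κ′ u′ y z′ (inl α₀) b`,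
`T = legChain (respStepBmSeq (toSite rr) Lc) m k`. -/
theorem codiff₁_push₃_chain_row_eq' (hrr : rr ∈ box (d + 1) Lc) (m k : ℕ) (hS : OneStepResolventKernel.LocStencil S Cs δ) (hδ : 0 < δ)
    (κ' : Fin (d + 1)) (u' y z' : Fin (d + 1) → ℤ) (α₀ : Fin (d + 1)) (b : OneStepResolventKernel.Fib d) :
    codiff₁ (fun α x => push₃ (legChain (respStepBmSeq (toSite rr) Lc) m k) (legChain (respStepBmSeq (toSite rr) Lc) m k)
        (legChain (respStepBmSeq (toSite rr) Lc) m k) S κ' u' x z' (Sum.inl α) b) y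
      = (((Lc : ℝ) ^ ((d + 1) * (k + 1)))⁻¹)
          * push₃ (fun _ => gaugeWt (Lc ^ (k + 1))) (legChain (respStepBmSeq (toSite rr) Lc) m k)
              (legChain (respStepBmSeq (toSite rr) Lc) m k) S κ' u' y z' (Sum.inl α₀) b :=
  PushRowCoarseWardChain.codiff₁_push₃_chain_row_eq hrr RespStepBmDecompPsi.legDecay_respStep_levels_holds m k hS hδ κ' u' y z' α₀ b

/-- NOT IN PRINT; OUR BOOKKEEPING (PART 2 §5 ⨾ `legDecay_respStep_levels_holds`).  **an2's FIELD-LEG TERM `⟨dz φ, W^F⟩` FOR THE DEPTH-`k` LETTER, NO LEG HYPOTHESIS** (bounded `φ`;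
the letter's row summability displayed). -/
theorem tsum_dz_mul_push₃_chain_row_eq' (hrr : rr ∈ box (d + 1) Lc) (m k : ℕ) (hS : OneStepResolventKernel.LocStencil S Cs δ) (hδ : 0 < δ)
    (κ' : Fin (d + 1)) (u' z' : Fin (d + 1) → ℤ) (α₀ : Fin (d + 1)) (b : OneStepResolventKernel.Fib d)
    {φ : Form0 (d + 1) ℝ} {B : ℝ} (hφ : ∀ y, |φ y| ≤ B)
    (hWs : ∀ α, Summable fun y => push₃ (legChain (respStepBmSeq (toSite rr) Lc) m k) (legChain (respStepBmSeq (toSite rr) Lc) m k)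
        (legChain (respStepBmSeq (toSite rr) Lc) m k) S κ' u' y z' (Sum.inl α) b) :
    ∑' y, ∑ α, dz φ α y * push₃ (legChain (respStepBmSeq (toSite rr) Lc) m k) (legChain (respStepBmSeq (toSite rr) Lc) m k)
        (legChain (respStepBmSeq (toSite rr) Lc) m k) S κ' u' y z' (Sum.inl α) b
      = (((Lc : ℝ) ^ ((d + 1) * (k + 1)))⁻¹)
          * ∑' y, φ y * push₃ (fun _ => gaugeWt (Lc ^ (k + 1))) (legChain (respStepBmSeq (toSite rr) Lc) m k)
              (legChain (respStepBmSeq (toSite rr) Lc) m k) S κ' u' y z' (Sum.inl α₀) b :=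
  PushRowCoarseWardChain.tsum_dz_mul_push₃_chain_row_eq hrr RespStepBmDecompPsi.legDecay_respStep_levels_holds m k hS hδ κ' u' z' α₀ b hφ hWs

/-- NOT IN PRINT; OUR BOOKKEEPING (PART 1 §4 ⨾ `decays_KStepUnit_levels`).  **THE ONE-STEP ROW CODIFFERENTIAL LAW, NO LEG HYPOTHESIS** (the literal's `push₃ (−T_m) T_m T_m S`). -/
theorem codiff₁_push₃_literal_row_eq' (hrr : rr ∈ box (d + 1) Lc) (m : ℕ) (hS : OneStepResolventKernel.LocStencil S Cs δ) (hδ : 0 < δ)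
    (κ' : Fin (d + 1)) (u' y z' : Fin (d + 1) → ℤ) (α₀ : Fin (d + 1)) (b : OneStepResolventKernel.Fib d) :
    codiff₁ (fun α x => push₃ (-respStepBm (toSite rr) Lc (Lc ^ m) (Lc ^ (m + 1))) (respStepBm (toSite rr) Lc (Lc ^ m) (Lc ^ (m + 1)))
        (respStepBm (toSite rr) Lc (Lc ^ m) (Lc ^ (m + 1))) S κ' u' x z' (Sum.inl α) b) y
      = -(((Lc : ℝ) ^ (d + 1))⁻¹) * push₃ (fun _ => gaugeWt Lc) (respStepBm (toSite rr) Lc (Lc ^ m) (Lc ^ (m + 1)))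
          (respStepBm (toSite rr) Lc (Lc ^ m) (Lc ^ (m + 1))) S κ' u' y z' (Sum.inl α₀) b := by
  obtain ⟨CK, mK, hmK, hK⟩ := RespStepBmDecompPsi.decays_KStepUnit_levels (d := d) (Lc := Lc) m
  exact PushRowCoarseWard.codiff₁_push₃_literal_row_eq hrr m hK hmK hS hδ κ' u' y z' α₀ b

end HypFree
end Summit.QuantumFields.BalabanUV.Beta.GAN24.DressedLegSeamLowerBound
end
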